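import Literature.Analysis.FluidPDE.FluidComputer.ThresholdLevelTableX
import HarnessLib

/-!
# Kernel run of the level-table checker over the WIDER gate-data box (all seven data within 1/300), chunks 0 … 3 (bp3 gen 13, layer 4: robustness variant X)

HONEST FRAMING: low prior, high value-of-information experiment on Tao's machine paradigm; NOT a
claim that NS blows up.

Four kernel evaluations (`decide +kernel`; no `native_decide`, no extra axioms) of `runSteps`
with the interval gate data `GIx` (all seven data within relative `1/300`, `δ ∈ [0, (1 + 1/300) δ₀]`),
25 steps each, from `Bc0` to `Bx4`.
-/

namespace Literature.Analysis.FluidPDE.FluidComputer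

namespace ThresholdLevelTable

set_option maxHeartbeats 10000000 in
set_option maxRecDepth 200000 in
/-- Chunk 0 of the wider-data-box table run (steps 0 … 24). [folklore] -/
theorem runX0 : runSteps 60 12 3 GIx RbIt Bc0 chunk0 560258274993937 = some Bx1 := by
  decide +kernel

set_option maxHeartbeats 10000000 in
set_option maxRecDepth 200000 in
/-- Chunk 1 of the wider-data-box table run (steps 25 … 49). [folklore] -/
theorem runX1 : runSteps 60 12 3 GIx RbIt Bx1 chunk1 666799089894214 = some Bx2 := by
  decide +kernel

set_option maxHeartbeats 10000000 in
set_option maxRecDepth 200000 in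
/-- Chunk 2 of the wider-data-box table run (steps 50 … 74). [folklore] -/
theorem runX2 : runSteps 60 12 3 GIx RbIt Bx2 chunk2 793600105752233 = some Bx3 := by
  decide +kernel

set_option maxHeartbeats 10000000 in
set_option maxRecDepth 200000 in
/-- Chunk 3 of the wider-data-box table run (steps 75 … 99). [folklore] -/
theorem runX3 : runSteps 60 12 3 GIx RbIt Bx3 chunk3 944514078370851 = some Bx4 := by
  decide +kernel

end ThresholdLevelTable

end Literature.Analysis.FluidPDE.FluidComputer
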